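import Summits.AtomisticToContinuum.FouriersLaw.Theorems.OddSectorIrreversibilityTapLeakBoundKickCone
import Summits.AtomisticToContinuum.FouriersLaw.Theorems.OddSectorIrreversibilityWitnessGlueReflection

/-!
# `TapLeakBound` (stmt-AtomisticToContinuum-15159), line `SketchIdeator2`, floor of `stub_kickCone`: left–right reflection

Helper file (`--supports stmt-AtomisticToContinuum-15159`) for crux
P = `Summit.AtomisticToContinuum.FouriersLaw.Theses.OddSectorIrreversibility.TapLeakBound`, registered stub `stub_kickCone`
(C′ `ResampledKickCone`), floor sub-stub `stub_floorReflect` (F8). The crux quantifies over BOTH contacts `b ∈ {0, N-1}`,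
while the floor of the kick cone is proved at the LEFT contact (kick of `p_0`). This file transports it to the RIGHT
contact by the site reflection `R : k ↦ N-1-k` (`siteReflection`, `Literature/…/KineticTheory/ChainReflection.lean`),
a symmetry of the closed pinned FPU-`β` chain:

* `detFlow_siteReflection` — the CLOSED flow is `R`-equivariant, `Φ_t (R x) = R (Φ_t x)` (the pathwise equivariance
  `OddSectorWitness.chainFlow_siteReflection` at zero friction and zero noise);
* `siteReflection_kick` — the momentum kick commutes with `R` up to the mirrored coordinate,
  `R (q, update p b p') = ((R x).1, update (R x).2 (rev b) p')`;
* `bondCurrent_rev_siteReflection` — the bond currents are `R`-odd with mirrored bond index, `j_{rev (i+1)} (R z) = -j_i z`;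
* `kickDiff_sq_siteReflection`, `integral_kickDiff_sq_siteReflection` — hence the squared kicked difference of the
  transported current `j_{rev(i+1)}` kicked at `rev b`, evaluated at `R x`, is that of `j_i` kicked at `b`, at `x`;
* `integral_integral_kickDiff_sq_siteReflection` — and, `μ_T` being `R`-invariant
  (`OddSectorWitness.measurePreserving_siteReflection_gibbsWeight`, change of variables by the measurable involution
  `siteReflectionEquiv`), the resampled-kick functionals at the two contacts agree (any kick law `ν` on `ℝ`);
* `stub_floorReflect` (registered sub-goal) — the specialisation `b = N-1`, `b' = 0 = rev b`, `ν = N(0, T)`.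

References: folklore (reflection covariance of the symmetric chain, cf. Bonetto–Lebowitz–Rey-Bellet 2000, §5).
Nothing here closes the item.
-/

noncomputable section

open MeasureTheory ProbabilityTheory Filter Topology Set Function
open scoped NNReal ENNReal

namespace Summit.AtomisticToContinuum.FouriersLaw.Theorems.OddSectorIrreversibility.TapLeak

open Literature.MathematicalPhysics.KineticTheory.HeatConduction
open Literature.MathematicalPhysics.KineticTheory
open Summit.AtomisticToContinuum.FouriersLaw.Theorems.ClosedConeSensitivity.Negative.ZeroFrictionDictionary
open Summit.AtomisticToContinuum.FouriersLaw.Theorems.OddSectorWitness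

/-! ### §F8.1 The reflection commutes with the closed flow, the kick and (up to sign and mirror) the currents -/

section Pointwise

variable {ω₂ lam β : ℝ}

/-- **The closed flow is reflection equivariant**: `Φ_t (R x) = R (Φ_t x)` (pathwise equivariance of the chain flow,
zero friction, zero noise — the reflected zero path is the zero path). [folklore] -/
theorem detFlow_siteReflection (hω : 0 < ω₂) (hl : 0 ≤ lam) (hβ : 0 ≤ β) (N : ℕ) (t : ℝ) (x : PhaseSpace N) :
    detFlow ω₂ lam β N t (siteReflection N x) = siteReflection N (detFlow ω₂ lam β N t x) := by
  unfold detFlow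
  exact chainFlow_siteReflection hω hl hβ le_rfl N x (η := fun _ _ => (0 : ℝ)) continuous_const t

/-- **The momentum kick commutes with the reflection up to the mirrored coordinate**:
`R (q, update p b p') = ((R x).1, update (R x).2 (rev b) p')`. [folklore] -/
theorem siteReflection_kick {N : ℕ} (x : PhaseSpace N) (b : Fin N) (p' : ℝ) :
    siteReflection N (x.1, Function.update x.2 b p') =
      ((siteReflection N x).1, Function.update (siteReflection N x).2 (Fin.rev b) p') := by
  show (x.1 ∘ Fin.rev, Function.update x.2 b p' ∘ Fin.rev) =
    (x.1 ∘ Fin.rev, Function.update (x.2 ∘ Fin.rev) (Fin.rev b) p')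
  rw [update_comp_rev]

/-- **The bond currents are reflection-odd with mirrored bond index**: for the bond `(i, i+1)`,
`j_{rev(i+1)} (R z) = -j_i (z)` (even FPU-`β` interaction). [folklore] -/
theorem bondCurrent_rev_siteReflection (γ : ℝ) {N : ℕ} (i j : Fin N) (hij : j.val = i.val + 1)
    (z : PhaseSpace N) :
    (pinnedChain ω₂ lam β γ).bondCurrent N (Fin.rev j) (siteReflection N z) =
      -(pinnedChain ω₂ lam β γ).bondCurrent N i z := by
  have hi := i.isLt
  have hj := j.isLt
  have h := (pinnedChain ω₂ lam β γ).bondCurrent_siteReflection (pinnedChain_V_neg ω₂ lam β γ) N (Fin.rev j)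
    (Fin.rev i) (by rw [Fin.val_rev, Fin.val_rev]; omega) z
  rwa [Fin.rev_rev] at h

/-- **Pointwise reflection identity for the squared kicked difference of a transported current**: the squared
difference of `j_{rev(i+1)} ∘ Φ_s` under the kick of the mirrored momentum `rev b`, evaluated at `R x`, equals the
squared difference of `j_i ∘ Φ_s` under the kick of `p_b`, at `x`. [folklore] -/
theorem kickDiff_sq_siteReflection (hω : 0 < ω₂) (hl : 0 ≤ lam) (hβ : 0 ≤ β) (γ : ℝ) {N : ℕ} (s : ℝ)
    (i j b : Fin N) (hij : j.val = i.val + 1) (x : PhaseSpace N) (p' : ℝ) :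
    ((pinnedChain ω₂ lam β γ).bondCurrent N (Fin.rev j) (detFlow ω₂ lam β N s
        ((siteReflection N x).1, Function.update (siteReflection N x).2 (Fin.rev b) p')) -
      (pinnedChain ω₂ lam β γ).bondCurrent N (Fin.rev j) (detFlow ω₂ lam β N s (siteReflection N x))) ^ 2 =
    ((pinnedChain ω₂ lam β γ).bondCurrent N i (detFlow ω₂ lam β N s (x.1, Function.update x.2 b p')) -
      (pinnedChain ω₂ lam β γ).bondCurrent N i (detFlow ω₂ lam β N s x)) ^ 2 := by
  rw [← siteReflection_kick, detFlow_siteReflection hω hl hβ, detFlow_siteReflection hω hl hβ,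
    bondCurrent_rev_siteReflection γ i j hij, bondCurrent_rev_siteReflection γ i j hij]
  ring

/-- The kick-averaged form of `kickDiff_sq_siteReflection` (any kick law `ν` on `ℝ`). [folklore] -/
theorem integral_kickDiff_sq_siteReflection (hω : 0 < ω₂) (hl : 0 ≤ lam) (hβ : 0 ≤ β) (γ : ℝ) {N : ℕ} (s : ℝ)
    (i j b : Fin N) (hij : j.val = i.val + 1) (ν : Measure ℝ) (x : PhaseSpace N) :
    ∫ p', ((pinnedChain ω₂ lam β γ).bondCurrent N (Fin.rev j) (detFlow ω₂ lam β N s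
        ((siteReflection N x).1, Function.update (siteReflection N x).2 (Fin.rev b) p')) -
      (pinnedChain ω₂ lam β γ).bondCurrent N (Fin.rev j) (detFlow ω₂ lam β N s (siteReflection N x))) ^ 2 ∂ν =
    ∫ p', ((pinnedChain ω₂ lam β γ).bondCurrent N i (detFlow ω₂ lam β N s (x.1, Function.update x.2 b p')) -
      (pinnedChain ω₂ lam β γ).bondCurrent N i (detFlow ω₂ lam β N s x)) ^ 2 ∂ν :=
  integral_congr_ae (Eventually.of_forall fun p' => kickDiff_sq_siteReflection hω hl hβ γ s i j b hij x p')

end Pointwise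

/-! ### §F8.2 The resampled-kick functional at the two contacts -/

section Integral

variable {ω₂ lam β : ℝ} (hω : 0 < ω₂) (hl : 0 ≤ lam) (hβ : 0 ≤ β)
include hω hl hβ

/-- **Reflection identity for the resampled-kick functional** (curried form of `stub_floorReflect`, any kick law `ν`):
`∫∫ (j_i(Φ_s(kick_b x)) − j_i(Φ_s x))² dν dμ_T = ∫∫ (j_{rev(i+1)}(Φ_s(kick_{rev b} x)) − j_{rev(i+1)}(Φ_s x))² dν dμ_T`
— change of variables `x = R x'` in the `R`-invariant Gibbs weight (no integrability needed: `R` is a measure-preserving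
measurable involution) and the pointwise identity `integral_kickDiff_sq_siteReflection`. [folklore] -/
theorem integral_integral_kickDiff_sq_siteReflection (γ : ℝ) (N : ℕ) (T s : ℝ) (i j b : Fin N)
    (hij : j.val = i.val + 1) (ν : Measure ℝ) :
    ∫ x, (∫ p', ((pinnedChain ω₂ lam β γ).bondCurrent N i (detFlow ω₂ lam β N s (x.1, Function.update x.2 b p')) -
      (pinnedChain ω₂ lam β γ).bondCurrent N i (detFlow ω₂ lam β N s x)) ^ 2 ∂ν) ∂(gibbsWeight ω₂ lam β γ N T) =
    ∫ x, (∫ p', ((pinnedChain ω₂ lam β γ).bondCurrent N (Fin.rev j)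
        (detFlow ω₂ lam β N s (x.1, Function.update x.2 (Fin.rev b) p')) -
      (pinnedChain ω₂ lam β γ).bondCurrent N (Fin.rev j) (detFlow ω₂ lam β N s x)) ^ 2 ∂ν)
      ∂(gibbsWeight ω₂ lam β γ N T) := by
  have hmp := measurePreserving_siteReflection_gibbsWeight (ω₂ := ω₂) (lam := lam) (β := β) γ N T
  refine Eq.trans ?_ (hmp.integral_comp (siteReflectionEquiv N).measurableEmbedding
    (fun y : PhaseSpace N => ∫ p', ((pinnedChain ω₂ lam β γ).bondCurrent N (Fin.rev j)
        (detFlow ω₂ lam β N s (y.1, Function.update y.2 (Fin.rev b) p')) -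
      (pinnedChain ω₂ lam β γ).bondCurrent N (Fin.rev j) (detFlow ω₂ lam β N s y)) ^ 2 ∂ν))
  exact integral_congr_ae (Eventually.of_forall fun x =>
    (integral_kickDiff_sq_siteReflection hω hl hβ γ s i j b hij ν x).symm)

end Integral

/-! ### §F8.3 The registered sub-goal -/

/-- **Sub-goal `stub_floorReflect`** (registered on the crux item stmt-AtomisticToContinuum-15159, line `SketchIdeator2`,
floor of `stub_kickCone`): for the pinned chain, the bond `(i, i+1)`, the RIGHT contact `b` (`b.val = N-1`) and the LEFT
contact `b'` (`b'.val = 0`), the resampled-kick squared-difference functional of the transported current `j_i` kicked at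
`p_b` equals that of the mirror current `j_{rev(i+1)}` kicked at `p_{b'}` — `integral_integral_kickDiff_sq_siteReflection`
with `rev b = b'` and the Gaussian kick law `N(0, T)`. [folklore] -/
theorem stub_floorReflect : ∀ (ω₂ lam β γ : ℝ), 0 < ω₂ → 0 ≤ lam → 0 ≤ β → ∀ (N : ℕ) (T s : ℝ) (i j b b' : Fin N), j.val = i.val + 1 → b.val = N - 1 → b'.val = 0 → ∫ x, (∫ p', ((pinnedChain ω₂ lam β γ).bondCurrent N i (Summit.AtomisticToContinuum.FouriersLaw.Theorems.ClosedConeSensitivity.Negative.ZeroFrictionDictionary.detFlow ω₂ lam β N s (x.1, Function.update x.2 b p')) - (pinnedChain ω₂ lam β γ).bondCurrent N i (Summit.AtomisticToContinuum.FouriersLaw.Theorems.ClosedConeSensitivity.Negative.ZeroFrictionDictionary.detFlow ω₂ lam β N s x)) ^ 2 ∂(ProbabilityTheory.gaussianReal 0 (Real.toNNReal T))) ∂(gibbsWeight ω₂ lam β γ N T) = ∫ x, (∫ p', ((pinnedChain ω₂ lam β γ).bondCurrent N (Fin.rev j) (Summit.AtomisticToContinuum.FouriersLaw.Theorems.ClosedConeSensitivity.Negative.ZeroFrictionDictionary.detFlow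 ω₂ lam β N s (x.1, Function.update x.2 b' p')) - (pinnedChain ω₂ lam β γ).bondCurrent N (Fin.rev j) (Summit.AtomisticToContinuum.FouriersLaw.Theorems.ClosedConeSensitivity.Negative.ZeroFrictionDictionary.detFlow ω₂ lam β N s x)) ^ 2 ∂(ProbabilityTheory.gaussianReal 0 (Real.toNNReal T))) ∂(gibbsWeight ω₂ lam β γ N T) := by
  intro ω₂ lam β γ hω hl hβ N T s i j b b' hij hb hb'
  have hblt := b.isLt
  obtain rfl : b' = Fin.rev b := Fin.ext (by rw [Fin.val_rev]; omega)
  exact integral_integral_kickDiff_sq_siteReflection hω hl hβ γ N T s i j b hij _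

end Summit.AtomisticToContinuum.FouriersLaw.Theorems.OddSectorIrreversibility.TapLeak

end
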